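import Summits.QuantumFields.YangMills.Theorems.BalabanUVNodesN12MinimiserFamilyAtRecordBj
import Summits.QuantumFields.YangMills.Theorems.BalabanUVNodesN12DirectSurjHsurjProxies
import Summits.QuantumFields.YangMills.Theorems.BalabanUVNodesN12TowerProxiesOfClass
import Summits.QuantumFields.YangMills.Theorems.BalabanUVNodesN12SiteProxiesOfClass
import Literature.MathematicalPhysics.QuantumFieldTheory.Balaban1983to89.B15Prop1PlaquetteLettersOfClass
import HarnessLib

/-!
# BalabanUVNodes ∕ N12 — `hsurj` (SURJECTIVITY OF `DΦ_{U₀}(0)` AT THE CHART OF RECORD) FOR EVERY (2.12)-CLASS MINIMISER, WITH NO NEAR-FLATNESS AND NO `SmallBelow` ON `U₀`;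
# THE (J0′) PRODUCER OF RECORD AT `𝐁_k(Z)` WITH ITS `hsurj` ROW DISCHARGED FROM THE CLASS
# ([Balaban1985Variational] Sect. C (44)–(48) p. 285, (82)–(83) p. 290; [Balaban1988Convergent] (2.2) p. 255, (2.10)–(2.13) pp. 256–257; [Balaban1989LargeFieldI] (1.74) p. 192, Prop. 1 p. 194)

Cell `pub-ymgap` (HUMAN RULINGS D-0062 ∕ D-0149), WIDTH SEAT `pub-ymgap-dag-n12-w6` g11 (node N12 = [B15]; key K1⁹ `stmt-QuantumFields-27364`, `--kind proof --supports … --as helper`;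
count-neutral).  THEOREMS ONLY (0 `def`, 0 `instance`, 0 `sorry`); composition BY NAME of landed kernel theorems: this lineage's (P4)′ PROXIES edition
`N12DirectSurjHsurjProxies.exists_rightInverse_letter_of_proxies` (g7, p678596), the lane's ρ5b `N12TowerProxiesOfClass.towerProxies_Bj_of_mem_class` (p677953) and §3b
`N12SiteProxiesOfClass.siteProxies_Bj_of_mem_class` (p679665), the lane's ρ4 `B15Prop1PlaquetteLettersOfClass.plaqSmallOn_towerBox_of_isMinimizer` (p675521), and dag-n12-w1 g4's
(J0′) producer of record `N12MinimiserFamilyAtRecordBj.hMin_atRecord_Bj_of_printLetters`.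

WHY (LOCATED-HSURJ, this seat, bus 2026-08-29 06:49Z; the (J0′)-PRODUCER-side twin of the lane's LOCATED-HSB ∕ plan g91's LOCATED-E1-HSB).  The (J0′) producer of record at the
record's `𝐁_k(Z)` — `hMin_atRecord_Bj_of_printLetters` — displays PER BASE FIELD, besides the two (0.4) guards `hsbQ`∕`hsbU`, the row
`hsurj : Function.Surjective (fderiv ℝ (msChart F 2 Kt k (Bj ν.M₁ Z k) (M˙U₀) U₀) 0)` («dag-n10-w1's letter; hypothesis-free near the flat configuration»).  Its only producers in
the tree, `N12GuardedLinAvgRightInverseBj.surjective_fderiv_msChart_Bj(_one ∕ _of_agreeOn)`, ask `‖coeField U₀ − 1‖ < ρ′` ON THE WHOLE TORUS — unsatisfiable at a (2.12) minimiser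
`U₀` pinned on `Γ₀ = Ω₁(Z)ᶜ` to data rough off `Z`, the large-field regime N12 exists for (not a gap in print: [Balaban1985Variational] (45) reads `U₀` on the constraint towers only).
The repair is already landed in pieces: the (P4)′ proxies edition produces a RIGHT INVERSE of `DΦ_{𝐁_k(Z),W,U₀}(0)` from ONE guarded proxy per constrained bond (agreeing with `U₀` on
`feeds c`), ONE per inner `j`-site (agreeing on the sharp towers of the rows there) and the tower-box plaquette letter at a per-height `εH` — and for a configuration of NODE 00's
class `regMSCoPOfRecord F 2 ν Kt k (maxDomT ν.M₁ Z)` all three come FROM THE CLASS (ρ5b: pure gauge on `Γ₀`, axial gauge of the tower box at positive levels; §3b; ρ4 with (2.13)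
separation), exactly as dag-n12-d's (D1)‴ `N12Prop1DirectOfClassOnly` §1 consumes them on the chart side.

CONTENTS.  §1 ★★★ `exists_rightInverse_Bj_of_isMinimizer_class` — for ANY (2.12) minimiser `U₀` over the class (any determining set `𝔹′`, any datum `W′`) and any multi-scale datum `W`
with `U₀` in its `𝐁_k(Z)`-fibre: a right inverse `H` of `fderiv ℝ (msChart F 2 Kt k (Bj ν.M₁ Z k) W U₀) 0` with the ℓ² letter `√Σ_b‖H v b‖² ≤ B‖v‖`; displayed are PER-HEIGHT letters
only — `hHB` (= p678596's ∀-body at `(εH, B)`), `hsbU : ‖↑V − 1‖ ≤ ρ″ → SmallBelow k V` (used on the axial-gauged BOX PROXIES, which are near-flat — never on `U₀`), the floors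
`6(d−1)L·εreg ≤ ρ″`, `εreg ≤ εH`, and the numerics `k+1 ≤ m+K`, `4L ≤ M₁`, `0 ≤ εreg`, `LᵏM₁ ∣ N₀`; ★★★ `surjective_fderiv_msChart_Bj_of_isMinimizer_class(_of_agreeOn)` — `hsurj` verbatim.
§2 `exists_hsurjLetters` — the three per-height letters are inhabited (`εH > 0` before `ν`; `B ≥ 0` per `(M₁, Z)`; `ρ″ > 0` per height), by p678596 and dag-n12-w4's
`Node00.exists_uniform_chartCurvature_sq_bound`.  §3 ★★★ `hMin_atRecord_Bj_of_printLetters_hsurjOfClass` — dag-n12-w1 g4's (J0′) producer at the class index `kc := k` of the knit's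
row, with the `hsurj` CONJUNCT OF `hbase` DROPPED (rows added: §1's per-height letters and floors, `k + 1 ≤ m + K`).

HONEST FRAMING.  Composition by name; per-height ∕ per-`(M₁,Z)` EXISTENCE constants (print's volume-uniform (46) NOT claimed); in §3 the rows `hsbQ`∕`hsbU` (plan g91 LOCATED-E1-HSB,
repair (r1)–(r3)) and dag-n12-w3's `t₀`-guards REMAIN displayed, so the producer as a whole is still a (0.4)-regime reading until those land; nothing of Bałaban's estimates asserted or
refuted; N12 NOT discharged; K1⁹ NOT closed; counts of record unmoved; one finite 𝕋⁴ programme at fixed ε — R4 closes only the conditional rung `BalabanLadder.UV`; no summit statement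
is proved here and NOT the Yang–Mills mass gap (Clay); nothing continuum ∕ ℝ⁴ ∕ OS.
-/

noncomputable section

namespace Summit.QuantumFields.YangMills.BalabanUVNodes.N12HsurjOfClass

open scoped BigOperators Matrix.Norms.L2Operator Topology
open Literature.MathematicalPhysics.QuantumFieldTheory.Balaban1983to89
open T4Continuum
open B15DeterminingSets GaugeField
open ExpMeanLog (expMeanLogSU deltaSU)
open T4AdjointCovarianceUnitary (lieSU)
open Node00
open B15SU2ChartHolomorphic (genE)
open B15Prop1AnalyticExtClause (cplxVec)
open B15Prop1ChartCalculusSU2 (E3)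
open T4CubeChartGnomonic (SU2)
open B14.Eq213DetSet (Bj maxDomT Bj_of_gt)
open B14.Eq213MaximalDomains (side)
open B14.Eq216Concrete (feeds)
open B5Eq118OneStroke (iterBlockOf)
open B15Eq112TorusCover (lift)
open T4AxialGaugeSmallField (boxPlaqs)
open T4ReflectionCone (three_le_L)
open Summit.QuantumFields.YangMills.Theorems.BlockAvgCorrector (stokesConst)
open Summit.QuantumFields.YangMills.BalabanUVNodes.N12MinimiserFamilyAtRecordBj (hMin_atRecord_Bj_of_printLetters)
open Summit.QuantumFields.YangMills.BalabanUVNodes.N12DirectSurjHsurjProxies (exists_rightInverse_letter_of_proxies)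
open Summit.QuantumFields.YangMills.BalabanUVNodes.N12TowerProxiesOfClass (towerProxies_Bj_of_mem_class)
open Summit.QuantumFields.YangMills.BalabanUVNodes.N12SiteProxiesOfClass (siteProxies_Bj_of_mem_class)
open B15Prop1PlaquetteLettersOfClass (plaqSmallOn_towerBox_of_isMinimizer)
open Literature.MathematicalPhysics.QuantumFieldTheory.BalabanImbrieJaffe1984to88.BIJ85Eq453GaugeField (qsstarGIter0)
open B15AveragingHolomorphic (iterMh)
open B15SU2ChartHolomorphic (expMulC logCoordC)
open B15ShellGauge193 (shellGauge)
open B15Extension193 (extend)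
open B16Sect1Backgrounds (toMS expMul)
open B15Prop1ChartSU2 (su2Chart)
open Metric (ball)

variable {F : T4Family} {k : ℕ}

/-! ## §1  A right inverse of `DΦ_{𝐁_k(Z),W,U₀}(0)` — hence `hsurj` — for every (2.12)-class minimiser, from the class -/

/-- ★★★ **A RIGHT INVERSE OF `DΦ_{𝐁_k(Z),W,U₀}(0)` FOR EVERY (2.12)-CLASS MINIMISER `U₀`, WITH NO NEAR-FLATNESS AND NO `SmallBelow` ON `U₀`.**  For a minimiser `U₀` of ANY constrained
problem over NODE 00's class `regMSCoPOfRecord F 2 ν Kt k (maxDomT ν.M₁ Z)` (any determining set `𝔹′`, any datum `W′` — only the class membership is read) and any multi-scale datum `W`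
with `U₀` in its `𝐁_k(Z)`-fibre: a map `H` with `fderiv ℝ (msChart F 2 Kt k (Bj ν.M₁ Z k) W U₀) 0 ∘ H = id` and `√Σ_b ‖H v b‖² ≤ B‖v‖`.  One application of this lineage's (P4)′ proxies
edition (the displayed per-height letter `hHB` = its ∀-body at `(εH, B)`), fed by the class: per-constrained-bond proxies (ρ5b), per-inner-site proxies (§3b), tower-box plaquette letter
at `εH ≥ εreg` (ρ4).  The radius letter `hsbU` is used on the near-flat axial-gauged box proxies only.
[cite: Balaban1985Variational, Sect. C (44)–(48) p.285, (82)–(83) p.290; Balaban1988Convergent, (2.2) p.255, (2.10)–(2.13) pp.256–257; Balaban1987RG1, (0.4) p.253] -/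
theorem exists_rightInverse_Bj_of_isMinimizer_class (ν : Node00.Stage7Numerics) (Kt : ℕ) (Z : Set (Site (F.P Kt) 0))
    (hkK : k + 1 ≤ (F.P Kt).m + (F.P Kt).K) (hM4 : 4 * (F.P Kt).L ≤ ν.M₁) (hdiv : side (F.P Kt).L ν.M₁ k ∣ (F.P Kt).sitesPerDir 0) (hε : 0 ≤ ν.εreg)
    -- per-HEIGHT letters: the near-flat radius of the (0.4) guards (dag-n12-w4), used on the box proxies only
    {ρ'' : ℝ} (hsbU : ∀ V : GaugeField (F.P Kt) 0 SU2, ‖coeField V - 1‖ ≤ ρ'' → SmallBelow (avOfRecord F 2 Kt) k V)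
    (hερ : 6 * ((((F.P Kt).d - 1 : ℕ)) : ℝ) * (F.P Kt).L * ν.εreg ≤ ρ'')
    -- per-HEIGHT ∕ per-`(M₁, Z)` letter: the ∀-body of this lineage's (P4)′ proxies edition `exists_rightInverse_letter_of_proxies` (p678596) at `(εH, B)`
    {εH B : ℝ}
    (hHB : ∀ (Wd : MSField (F.P Kt) SU2) (U₀ : GaugeField (F.P Kt) 0 SU2),
      AgreeOn (Bj ν.M₁ Z k) (avgFamily (avOfRecord F 2 Kt) U₀) Wd →
      (∀ i' : Fin (constrCard (Bj ν.M₁ Z k) k), ∃ U' : GaugeField (F.P Kt) 0 SU2,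
        (∀ b ∈ feeds (((constrEnum (Bj ν.M₁ Z k) k).symm i').1 : ℕ) ((constrEnum (Bj ν.M₁ Z k) k).symm i').2.1, U' b = U₀ b) ∧
          SmallBelow (avOfRecord F 2 Kt) k U') →
      (∀ (j : ℕ), 1 ≤ j → j ≤ k → ∀ y : Site (F.P Kt) j, embIter j y ∈ maxDomT ν.M₁ Z j → ∃ U' : GaugeField (F.P Kt) 0 SU2,
        (∀ c : PBond (F.P Kt) j, (c.src = y ∨ c.tgt = y) → ∀ b₀ : PBond (F.P Kt) 0,
          (iterBlockOf j b₀.src = c.src ∨ iterBlockOf j b₀.src = c.tgt) → (iterBlockOf j b₀.tgt = c.src ∨ iterBlockOf j b₀.tgt = c.tgt) → U' b₀ = U₀ b₀) ∧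
        SmallBelow (avOfRecord F 2 Kt) k U') →
      (∀ (j : ℕ), 1 ≤ j → j ≤ k → ∀ y : Site (F.P Kt) j, embIter j y ∈ maxDomT ν.M₁ Z j →
        PlaqSmallOn (boxPlaqs (fun κ => lift (F.P Kt) (embIter j y) κ - ((((F.P Kt).L ^ j : ℕ) : ℤ) + ((((F.P Kt).L ^ j - 1) / 2 : ℕ) : ℤ)))
          (fun κ => lift (F.P Kt) (embIter j y) κ + ((((F.P Kt).L ^ j : ℕ) : ℤ) + ((((F.P Kt).L ^ j - 1) / 2 : ℕ) : ℤ))) : Set (Plaq (F.P Kt) 0)) εH U₀) →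
      ∃ H : (Fin (constrCard (Bj ν.M₁ Z k) k) → lieSU (Fin 2)) → PBond (F.P Kt) 0 → lieSU (Fin 2),
        (∀ v, fderiv ℝ (msChart F 2 Kt k (Bj ν.M₁ Z k) Wd U₀) 0 (H v) = v) ∧ ∀ v, Real.sqrt (∑ b, ‖H v b‖ ^ 2) ≤ B * ‖v‖)
    (hεH : ν.εreg ≤ εH)
    -- the minimiser: only its class membership is read
    {𝔹' : DetSet (F.P Kt)} {W' : MSField (F.P Kt) SU2} {U₀ : GaugeField (F.P Kt) 0 SU2}
    (hmin : IsMinimizer (avOfRecord F 2 Kt) (regMSCoPOfRecord F 2 ν Kt k (maxDomT ν.M₁ Z)) 𝔹' W' U₀)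
    {W : MSField (F.P Kt) SU2} (hW : AgreeOn (Bj ν.M₁ Z k) (avgFamily (avOfRecord F 2 Kt) U₀) W) :
    ∃ H : (Fin (constrCard (Bj ν.M₁ Z k) k) → lieSU (Fin 2)) → PBond (F.P Kt) 0 → lieSU (Fin 2),
      (∀ v, fderiv ℝ (msChart F 2 Kt k (Bj ν.M₁ Z k) W U₀) 0 (H v) = v) ∧ ∀ v, Real.sqrt (∑ b, ‖H v b‖ ^ 2) ≤ B * ‖v‖ := by
  have hL := three_le_L (F.P Kt)
  have hM2 : 2 ≤ ν.M₁ := by omega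
  have hrad : (F.P Kt).L + ((F.P Kt).L - 1) / 2 ≤ ν.M₁ := by omega
  exact hHB W U₀ hW (towerProxies_Bj_of_mem_class ν Kt Z hkK hM4 hdiv hε hsbU hερ hmin.1)
    (siteProxies_Bj_of_mem_class ν Kt Z hkK hM4 hdiv hε hsbU hερ hmin.1)
    fun j hj1 hjk y hy => plaqSmallOn_towerBox_of_isMinimizer ν Kt Z hmin hM2 hrad hdiv hε hεH hj1 hjk y hy

/-- ★★★ **`hsurj` FOR A GENERAL DATUM, FROM THE CLASS**: at every (2.12)-class minimiser `U₀` (class membership only is read) and every multi-scale datum `W` with `U₀` in its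
`𝐁_k(Z)`-fibre, `fderiv ℝ (msChart F 2 Kt k (Bj ν.M₁ Z k) W U₀) 0` is onto — no near-flatness, no `SmallBelow` on `U₀`; per-height letters `hHB`, `hsbU` and floors as in
`exists_rightInverse_Bj_of_isMinimizer_class`. [cite: Balaban1985Variational, Sect. C (44)–(48) p.285, (82)–(83) p.290; Balaban1988Convergent, (2.10)–(2.13) pp.256–257] -/
theorem surjective_fderiv_msChart_Bj_of_isMinimizer_class_of_agreeOn (ν : Node00.Stage7Numerics) (Kt : ℕ) (Z : Set (Site (F.P Kt) 0))
    (hkK : k + 1 ≤ (F.P Kt).m + (F.P Kt).K) (hM4 : 4 * (F.P Kt).L ≤ ν.M₁) (hdiv : side (F.P Kt).L ν.M₁ k ∣ (F.P Kt).sitesPerDir 0) (hε : 0 ≤ ν.εreg)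
    {ρ'' : ℝ} (hsbU : ∀ V : GaugeField (F.P Kt) 0 SU2, ‖coeField V - 1‖ ≤ ρ'' → SmallBelow (avOfRecord F 2 Kt) k V)
    (hερ : 6 * ((((F.P Kt).d - 1 : ℕ)) : ℝ) * (F.P Kt).L * ν.εreg ≤ ρ'')
    {εH B : ℝ}
    (hHB : ∀ (Wd : MSField (F.P Kt) SU2) (U₀ : GaugeField (F.P Kt) 0 SU2),
      AgreeOn (Bj ν.M₁ Z k) (avgFamily (avOfRecord F 2 Kt) U₀) Wd →
      (∀ i' : Fin (constrCard (Bj ν.M₁ Z k) k), ∃ U' : GaugeField (F.P Kt) 0 SU2,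
        (∀ b ∈ feeds (((constrEnum (Bj ν.M₁ Z k) k).symm i').1 : ℕ) ((constrEnum (Bj ν.M₁ Z k) k).symm i').2.1, U' b = U₀ b) ∧
          SmallBelow (avOfRecord F 2 Kt) k U') →
      (∀ (j : ℕ), 1 ≤ j → j ≤ k → ∀ y : Site (F.P Kt) j, embIter j y ∈ maxDomT ν.M₁ Z j → ∃ U' : GaugeField (F.P Kt) 0 SU2,
        (∀ c : PBond (F.P Kt) j, (c.src = y ∨ c.tgt = y) → ∀ b₀ : PBond (F.P Kt) 0,
          (iterBlockOf j b₀.src = c.src ∨ iterBlockOf j b₀.src = c.tgt) → (iterBlockOf j b₀.tgt = c.src ∨ iterBlockOf j b₀.tgt = c.tgt) → U' b₀ = U₀ b₀) ∧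
        SmallBelow (avOfRecord F 2 Kt) k U') →
      (∀ (j : ℕ), 1 ≤ j → j ≤ k → ∀ y : Site (F.P Kt) j, embIter j y ∈ maxDomT ν.M₁ Z j →
        PlaqSmallOn (boxPlaqs (fun κ => lift (F.P Kt) (embIter j y) κ - ((((F.P Kt).L ^ j : ℕ) : ℤ) + ((((F.P Kt).L ^ j - 1) / 2 : ℕ) : ℤ)))
          (fun κ => lift (F.P Kt) (embIter j y) κ + ((((F.P Kt).L ^ j : ℕ) : ℤ) + ((((F.P Kt).L ^ j - 1) / 2 : ℕ) : ℤ))) : Set (Plaq (F.P Kt) 0)) εH U₀) →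
      ∃ H : (Fin (constrCard (Bj ν.M₁ Z k) k) → lieSU (Fin 2)) → PBond (F.P Kt) 0 → lieSU (Fin 2),
        (∀ v, fderiv ℝ (msChart F 2 Kt k (Bj ν.M₁ Z k) Wd U₀) 0 (H v) = v) ∧ ∀ v, Real.sqrt (∑ b, ‖H v b‖ ^ 2) ≤ B * ‖v‖)
    (hεH : ν.εreg ≤ εH)
    {𝔹' : DetSet (F.P Kt)} {W' : MSField (F.P Kt) SU2} {U₀ : GaugeField (F.P Kt) 0 SU2}
    (hmin : IsMinimizer (avOfRecord F 2 Kt) (regMSCoPOfRecord F 2 ν Kt k (maxDomT ν.M₁ Z)) 𝔹' W' U₀)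
    {W : MSField (F.P Kt) SU2} (hW : AgreeOn (Bj ν.M₁ Z k) (avgFamily (avOfRecord F 2 Kt) U₀) W) :
    Function.Surjective (fderiv ℝ (msChart F 2 Kt k (Bj ν.M₁ Z k) W U₀) 0) := by
  obtain ⟨H, hH, -⟩ := exists_rightInverse_Bj_of_isMinimizer_class ν Kt Z hkK hM4 hdiv hε hsbU hερ hHB hεH hmin hW
  exact fun v => ⟨H v, hH v⟩

/-- ★★★ **`hsurj` AT THE CHART OF RECORD `msChart F 2 Kt k (Bj ν.M₁ Z k) (M˙U₀) U₀`, FROM THE CLASS** — the binder `hsurj` of dag-n12-w1 g4's (J0′) producer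
`N12MinimiserFamilyAtRecordBj.hMin_atRecord_Bj_of_printLetters` ∕ of dag-n12-w3's `N12ForestSliceCurved.exists_forest_preimage_of_surjective_curved` VERBATIM, at every (2.12)-class
minimiser `U₀` (class membership only is read); no near-flatness, no `SmallBelow` on `U₀`.
[cite: Balaban1985Variational, Sect. C (44)–(48) p.285, (82)–(83) p.290; Balaban1988Convergent, (2.10)–(2.13) pp.256–257] -/
theorem surjective_fderiv_msChart_Bj_of_isMinimizer_class (ν : Node00.Stage7Numerics) (Kt : ℕ) (Z : Set (Site (F.P Kt) 0))
    (hkK : k + 1 ≤ (F.P Kt).m + (F.P Kt).K) (hM4 : 4 * (F.P Kt).L ≤ ν.M₁) (hdiv : side (F.P Kt).L ν.M₁ k ∣ (F.P Kt).sitesPerDir 0) (hε : 0 ≤ ν.εreg)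
    {ρ'' : ℝ} (hsbU : ∀ V : GaugeField (F.P Kt) 0 SU2, ‖coeField V - 1‖ ≤ ρ'' → SmallBelow (avOfRecord F 2 Kt) k V)
    (hερ : 6 * ((((F.P Kt).d - 1 : ℕ)) : ℝ) * (F.P Kt).L * ν.εreg ≤ ρ'')
    {εH B : ℝ}
    (hHB : ∀ (Wd : MSField (F.P Kt) SU2) (U₀ : GaugeField (F.P Kt) 0 SU2),
      AgreeOn (Bj ν.M₁ Z k) (avgFamily (avOfRecord F 2 Kt) U₀) Wd →
      (∀ i' : Fin (constrCard (Bj ν.M₁ Z k) k), ∃ U' : GaugeField (F.P Kt) 0 SU2,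
        (∀ b ∈ feeds (((constrEnum (Bj ν.M₁ Z k) k).symm i').1 : ℕ) ((constrEnum (Bj ν.M₁ Z k) k).symm i').2.1, U' b = U₀ b) ∧
          SmallBelow (avOfRecord F 2 Kt) k U') →
      (∀ (j : ℕ), 1 ≤ j → j ≤ k → ∀ y : Site (F.P Kt) j, embIter j y ∈ maxDomT ν.M₁ Z j → ∃ U' : GaugeField (F.P Kt) 0 SU2,
        (∀ c : PBond (F.P Kt) j, (c.src = y ∨ c.tgt = y) → ∀ b₀ : PBond (F.P Kt) 0,
          (iterBlockOf j b₀.src = c.src ∨ iterBlockOf j b₀.src = c.tgt) → (iterBlockOf j b₀.tgt = c.src ∨ iterBlockOf j b₀.tgt = c.tgt) → U' b₀ = U₀ b₀) ∧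
        SmallBelow (avOfRecord F 2 Kt) k U') →
      (∀ (j : ℕ), 1 ≤ j → j ≤ k → ∀ y : Site (F.P Kt) j, embIter j y ∈ maxDomT ν.M₁ Z j →
        PlaqSmallOn (boxPlaqs (fun κ => lift (F.P Kt) (embIter j y) κ - ((((F.P Kt).L ^ j : ℕ) : ℤ) + ((((F.P Kt).L ^ j - 1) / 2 : ℕ) : ℤ)))
          (fun κ => lift (F.P Kt) (embIter j y) κ + ((((F.P Kt).L ^ j : ℕ) : ℤ) + ((((F.P Kt).L ^ j - 1) / 2 : ℕ) : ℤ))) : Set (Plaq (F.P Kt) 0)) εH U₀) →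
      ∃ H : (Fin (constrCard (Bj ν.M₁ Z k) k) → lieSU (Fin 2)) → PBond (F.P Kt) 0 → lieSU (Fin 2),
        (∀ v, fderiv ℝ (msChart F 2 Kt k (Bj ν.M₁ Z k) Wd U₀) 0 (H v) = v) ∧ ∀ v, Real.sqrt (∑ b, ‖H v b‖ ^ 2) ≤ B * ‖v‖)
    (hεH : ν.εreg ≤ εH)
    {𝔹' : DetSet (F.P Kt)} {W' : MSField (F.P Kt) SU2} {U₀ : GaugeField (F.P Kt) 0 SU2}
    (hmin : IsMinimizer (avOfRecord F 2 Kt) (regMSCoPOfRecord F 2 ν Kt k (maxDomT ν.M₁ Z)) 𝔹' W' U₀) :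
    Function.Surjective (fderiv ℝ (msChart F 2 Kt k (Bj ν.M₁ Z k) (avgFamily (avOfRecord F 2 Kt) U₀) U₀) 0) :=
  surjective_fderiv_msChart_Bj_of_isMinimizer_class_of_agreeOn ν Kt Z hkK hM4 hdiv hε hsbU hερ hHB hεH hmin fun _ _ _ => rfl

/-! ## §2  The per-height letters are inhabited (junction by `choose`; count-neutral) -/

/-- **JUNCTION (count-neutral)**: the three per-height letters of §1 are inhabited by their producers — `εH > 0` per height `k` BEFORE `ν` and `B ≥ 0` per `(M₁, Z)` by this lineage's
`exists_rightInverse_letter_of_proxies` (p678596; `k + 1 ≤ m + K`, `1 ≤ M₁`, (2.13)'s divisibility), `ρ″ > 0` per height by dag-n12-w4's `Node00.exists_uniform_chartCurvature_sq_bound`.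
[cite: Balaban1985Variational, (83) p.290, (44)–(47) p.285; Balaban1988Convergent, (2.2) p.255, (2.11)–(2.13) pp.256–257] -/
theorem exists_hsurjLetters (Kt : ℕ) (hkK : k + 1 ≤ (F.P Kt).m + (F.P Kt).K) :
    ∃ ρ'' εH : ℝ, 0 < ρ'' ∧ 0 < εH ∧
      (∀ V : GaugeField (F.P Kt) 0 SU2, ‖coeField V - 1‖ ≤ ρ'' → SmallBelow (avOfRecord F 2 Kt) k V) ∧
      ∀ (M₁ : ℕ) (_ : 1 ≤ M₁) (Z : Set (Site (F.P Kt) 0)) (_ : side (F.P Kt).L M₁ k ∣ (F.P Kt).sitesPerDir 0), ∃ B : ℝ, 0 ≤ B ∧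
      ∀ (Wd : MSField (F.P Kt) SU2) (U₀ : GaugeField (F.P Kt) 0 SU2),
      AgreeOn (Bj M₁ Z k) (avgFamily (avOfRecord F 2 Kt) U₀) Wd →
      (∀ i' : Fin (constrCard (Bj M₁ Z k) k), ∃ U' : GaugeField (F.P Kt) 0 SU2,
        (∀ b ∈ feeds (((constrEnum (Bj M₁ Z k) k).symm i').1 : ℕ) ((constrEnum (Bj M₁ Z k) k).symm i').2.1, U' b = U₀ b) ∧
          SmallBelow (avOfRecord F 2 Kt) k U') →
      (∀ (j : ℕ), 1 ≤ j → j ≤ k → ∀ y : Site (F.P Kt) j, embIter j y ∈ maxDomT M₁ Z j → ∃ U' : GaugeField (F.P Kt) 0 SU2,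
        (∀ c : PBond (F.P Kt) j, (c.src = y ∨ c.tgt = y) → ∀ b₀ : PBond (F.P Kt) 0,
          (iterBlockOf j b₀.src = c.src ∨ iterBlockOf j b₀.src = c.tgt) → (iterBlockOf j b₀.tgt = c.src ∨ iterBlockOf j b₀.tgt = c.tgt) → U' b₀ = U₀ b₀) ∧
        SmallBelow (avOfRecord F 2 Kt) k U') →
      (∀ (j : ℕ), 1 ≤ j → j ≤ k → ∀ y : Site (F.P Kt) j, embIter j y ∈ maxDomT M₁ Z j →
        PlaqSmallOn (boxPlaqs (fun κ => lift (F.P Kt) (embIter j y) κ - ((((F.P Kt).L ^ j : ℕ) : ℤ) + ((((F.P Kt).L ^ j - 1) / 2 : ℕ) : ℤ)))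
          (fun κ => lift (F.P Kt) (embIter j y) κ + ((((F.P Kt).L ^ j : ℕ) : ℤ) + ((((F.P Kt).L ^ j - 1) / 2 : ℕ) : ℤ))) : Set (Plaq (F.P Kt) 0)) εH U₀) →
      ∃ H : (Fin (constrCard (Bj M₁ Z k) k) → lieSU (Fin 2)) → PBond (F.P Kt) 0 → lieSU (Fin 2),
        (∀ v, fderiv ℝ (msChart F 2 Kt k (Bj M₁ Z k) Wd U₀) 0 (H v) = v) ∧ ∀ v, Real.sqrt (∑ b, ‖H v b‖ ^ 2) ≤ B * ‖v‖ := by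
  obtain ⟨εH, hεH, hB⟩ := exists_rightInverse_letter_of_proxies (F := F) (N := 2) (K := Kt) (k := k) hkK
  obtain ⟨M₂, ρ'', -, hρ'', hsbU, -⟩ := Node00.exists_uniform_chartCurvature_sq_bound (F := F) (N := 2) (K := Kt) k
  exact ⟨ρ'', εH, hρ'', hεH, hsbU, hB⟩

/-! ## §3  The (J0′) producer of record at `𝐁_k(Z)` with `hsurj` DISCHARGED from the class -/

/-- ★★★ **(J0′) `hMin` AT THE RECORD's `𝐁_k(Z)` FROM PRINT's PER-BASE-FIELD LETTERS — THE `hsurj` ROW GONE.**  dag-n12-w1 g4's `hMin_atRecord_Bj_of_printLetters` at the knit's class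
index `kc := k`, with the conjunct «`DΦ_{U₀}(0)` onto» of `hbase` REMOVED: it is supplied per base field by §1 at the base minimiser `U₀` (class membership `hmin.1`).  Per base field the
consumer now supplies: the (2.12) minimiser `U₀` with the two (0.4) guards `hsbQ`∕`hsbU` (plan g91 LOCATED-E1-HSB; repair (r1)–(r3) in flight) and dag-n12-w3's plaquette guards `t₀`
(both still (0.4)-regime rows — displayed, not asserted); (β) on every forest axial slice; (T1@q₀) over the closure of the class.  Rows added once per instance: the per-height
letters `hsbU′`∕`hHB` of §1 with the floors `6(d−1)L·εreg ≤ ρ″`, `εreg ≤ εH` (inhabited by §2 before `ν`), and `k + 1 ≤ m + K`.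
[cite: Balaban1985Variational, Thm 1 p.279, (1)–(2), (6)–(7) pp.277–279, (16)–(18) p.280, Sect. C (44)–(48) p.285, (82)–(83) p.290, Prop. 8 p.305, Prop. 9 (190) p.309; Balaban1985RegularSpaces, (1.19) p.79; Balaban1989LargeFieldI, (1.74) p.192, Prop. 1 p.194; Balaban1989LargeFieldII, (1.9) p.358, (1.12) p.359; Balaban1988Convergent, (2.2) p.255, (2.10)–(2.13) pp.256–257; Balaban1985Averaging, Prop. 2 (52)–(54) p.26] -/
theorem hMin_atRecord_Bj_of_printLetters_hsurjOfClass (ν : Node00.Stage7Numerics) (Kt : ℕ) (Z : Set (Site (F.P Kt) 0))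
    (Λ : Set (Site (F.P Kt) k)) (lo hi : Fin (F.P Kt).d → ℤ) (hkK : k + 1 ≤ (F.P Kt).m + (F.P Kt).K) (hk1 : 1 ≤ k)
    (hdiv : side (F.P Kt).L ν.M₁ k ∣ (F.P Kt).sitesPerDir 0) (hfloor : ((F.P Kt).d + 14) * (F.P Kt).L ≤ ν.M₁) (hε : 0 < ν.εreg)
    (hα3 : (143 * (((((F.P Kt).d + 4 : ℕ) : ℝ)) ^ 2 / 4) ^ 2) * (2 * ((F.P Kt).L : ℝ) ^ 2 * ν.εreg) ≤ 1 / 3)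
    (hα2 : 2 * (2 * ((F.P Kt).L : ℝ) ^ 2 * ν.εreg) ≤ 2 * deltaSU (Fin 2) / ((((F.P Kt).d + 4) * (F.P Kt).L : ℕ) : ℝ) ^ 2)
    -- the per-HEIGHT letters of §1 (inhabited by §2 before `ν`) and their floors
    {ρ'' : ℝ} (hsbU' : ∀ V : GaugeField (F.P Kt) 0 SU2, ‖coeField V - 1‖ ≤ ρ'' → SmallBelow (avOfRecord F 2 Kt) k V)
    (hερ : 6 * ((((F.P Kt).d - 1 : ℕ)) : ℝ) * (F.P Kt).L * ν.εreg ≤ ρ'')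
    {εH B : ℝ}
    (hHB : ∀ (Wd : MSField (F.P Kt) SU2) (U₀ : GaugeField (F.P Kt) 0 SU2),
      AgreeOn (Bj ν.M₁ Z k) (avgFamily (avOfRecord F 2 Kt) U₀) Wd →
      (∀ i' : Fin (constrCard (Bj ν.M₁ Z k) k), ∃ U' : GaugeField (F.P Kt) 0 SU2,
        (∀ b ∈ feeds (((constrEnum (Bj ν.M₁ Z k) k).symm i').1 : ℕ) ((constrEnum (Bj ν.M₁ Z k) k).symm i').2.1, U' b = U₀ b) ∧
          SmallBelow (avOfRecord F 2 Kt) k U') →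
      (∀ (j : ℕ), 1 ≤ j → j ≤ k → ∀ y : Site (F.P Kt) j, embIter j y ∈ maxDomT ν.M₁ Z j → ∃ U' : GaugeField (F.P Kt) 0 SU2,
        (∀ c : PBond (F.P Kt) j, (c.src = y ∨ c.tgt = y) → ∀ b₀ : PBond (F.P Kt) 0,
          (iterBlockOf j b₀.src = c.src ∨ iterBlockOf j b₀.src = c.tgt) → (iterBlockOf j b₀.tgt = c.src ∨ iterBlockOf j b₀.tgt = c.tgt) → U' b₀ = U₀ b₀) ∧
        SmallBelow (avOfRecord F 2 Kt) k U') →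
      (∀ (j : ℕ), 1 ≤ j → j ≤ k → ∀ y : Site (F.P Kt) j, embIter j y ∈ maxDomT ν.M₁ Z j →
        PlaqSmallOn (boxPlaqs (fun κ => lift (F.P Kt) (embIter j y) κ - ((((F.P Kt).L ^ j : ℕ) : ℤ) + ((((F.P Kt).L ^ j - 1) / 2 : ℕ) : ℤ)))
          (fun κ => lift (F.P Kt) (embIter j y) κ + ((((F.P Kt).L ^ j : ℕ) : ℤ) + ((((F.P Kt).L ^ j - 1) / 2 : ℕ) : ℤ))) : Set (Plaq (F.P Kt) 0)) εH U₀) →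
      ∃ H : (Fin (constrCard (Bj ν.M₁ Z k) k) → lieSU (Fin 2)) → PBond (F.P Kt) 0 → lieSU (Fin 2),
        (∀ v, fderiv ℝ (msChart F 2 Kt k (Bj ν.M₁ Z k) Wd U₀) 0 (H v) = v) ∧ ∀ v, Real.sqrt (∑ b, ‖H v b‖ ^ 2) ≤ B * ‖v‖)
    (hεH : ν.εreg ≤ εH)
    (ext : GaugeField (F.P Kt) k SU2 → GaugeField (F.P Kt) k SU2) (hext : ∀ W, ext W = extend Λ (shellGauge W lo hi) W)
    {K : Set (GaugeField (F.P Kt) k SU2)} (hK : IsCompact K) {𝓐₀ : ℝ} (h𝓐₀ : 1 < 𝓐₀)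
    (hbase : ∀ Vk ∈ K, ∃ U₀ : GaugeField (F.P Kt) 0 SU2,
      IsMinimizer (Node00.avOfRecord F 2 Kt) (Node00.regMSCoPOfRecord F 2 ν Kt k (maxDomT ν.M₁ Z)) (Bj ν.M₁ Z k)
        (avgFamily (Node00.avOfRecord F 2 Kt) (qsstarGIter0 k (ext Vk))) U₀ ∧
      SmallBelow (Node00.avOfRecord F 2 Kt) k (qsstarGIter0 k (ext Vk)) ∧
      SmallBelow (Node00.avOfRecord F 2 Kt) k U₀ ∧
      -- guards in dag-n12-w3's currency (NO surjectivity row any more)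
      (∃ t₀ : ℝ, 0 < t₀ ∧ stokesConst (F.P Kt) * t₀ < deltaSU (Fin 2) ∧ ∀ i, i < k → PlaqSmall t₀ (Averaging.iter (Node00.avOfRecord F 2 Kt) i U₀)) ∧
      -- DISPLAYED (β) ON EVERY FOREST AXIAL SLICE through the constrained towers of `𝐁_k(Z)`
      (∀ (S : Submodule ℂ (VecField (F.P Kt) 0 (EuclideanSpace ℂ (Fin 3)))) (path : Site (F.P Kt) 0 → List (LStep (F.P Kt) 0)),
        (∀ x, ∀ s ∈ path x, ∃ x' x'' : Site (F.P Kt) 0, path x'' = path x' ++ [s] ∧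
          (s.fwd = true → s.bond.src = x' ∧ s.bond.tgt = x'') ∧ (s.fwd = false → s.bond.src = x'' ∧ s.bond.tgt = x')) →
        (∀ j, j ≤ k → ∀ c ∈ bondsOf (Bj ν.M₁ Z k j), path (embIter j c.src) = [] ∧ path (embIter j c.tgt) = []) →
        (∀ X : VecField (F.P Kt) 0 (EuclideanSpace ℂ (Fin 3)), X ∈ S ↔ ∀ x, ∀ s ∈ path x, X s.bond = 0) →
        ∀ ℓ₀ : (Fin (constrCard (Bj ν.M₁ Z k) k) → EuclideanSpace ℂ (Fin 3)) →L[ℂ] ℂ,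
          fderiv ℂ (fun X : S => ∑ p : Plaq (F.P Kt) 0, (1 - (expMulC (X : VecField (F.P Kt) 0 (EuclideanSpace ℂ (Fin 3))) (coeField U₀) ⟨p.src, p.μ⟩ *
            expMulC (X : VecField (F.P Kt) 0 (EuclideanSpace ℂ (Fin 3))) (coeField U₀) ⟨p.src.shift p.μ, p.ν⟩ *
            Matrix.adjugate (expMulC (X : VecField (F.P Kt) 0 (EuclideanSpace ℂ (Fin 3))) (coeField U₀) ⟨p.src.shift p.ν, p.μ⟩) *
            Matrix.adjugate (expMulC (X : VecField (F.P Kt) 0 (EuclideanSpace ℂ (Fin 3))) (coeField U₀) ⟨p.src, p.ν⟩)).trace / 2)) 0 =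
            ℓ₀.comp (fderiv ℂ (fun (X : S) (i : Fin (constrCard (Bj ν.M₁ Z k) k)) =>
              logCoordC (star ((avgFamily (Node00.avOfRecord F 2 Kt) (qsstarGIter0 k (ext Vk))
                ((constrEnum (Bj ν.M₁ Z k) k).symm i).1 ((constrEnum (Bj ν.M₁ Z k) k).symm i).2.1 : SU2) : Matrix (Fin 2) (Fin 2) ℂ) *
                iterMh ((constrEnum (Bj ν.M₁ Z k) k).symm i).1 (expMulC (X : VecField (F.P Kt) 0 (EuclideanSpace ℂ (Fin 3))) (coeField U₀))
                  ((constrEnum (Bj ν.M₁ Z k) k).symm i).2.1)) 0) →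
          ∀ (p : VecField (F.P Kt) 0 E3) (hp : cplxVec p ∈ S), p ≠ 0 →
            (∀ i : Fin (constrCard (Bj ν.M₁ Z k) k), dIterL ((constrEnum (Bj ν.M₁ Z k) k).symm i).1 (coeField U₀)
              (fun b => (∑ a : Fin 3, ((p b a : ℝ) : ℂ) • genE a) * ((U₀ b : SU2) : Matrix (Fin 2) (Fin 2) ℂ)) ((constrEnum (Bj ν.M₁ Z k) k).symm i).2.1 = 0) →
            0 < deriv (deriv (fun t : ℝ => wilsonAction4 (expMul su2Chart (t • p) U₀) -
              (ℓ₀ ((fun (X : S) (i : Fin (constrCard (Bj ν.M₁ Z k) k)) =>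
                logCoordC (star ((avgFamily (Node00.avOfRecord F 2 Kt) (qsstarGIter0 k (ext Vk))
                  ((constrEnum (Bj ν.M₁ Z k) k).symm i).1 ((constrEnum (Bj ν.M₁ Z k) k).symm i).2.1 : SU2) : Matrix (Fin 2) (Fin 2) ℂ) *
                  iterMh ((constrEnum (Bj ν.M₁ Z k) k).symm i).1 (expMulC (X : VecField (F.P Kt) 0 (EuclideanSpace ℂ (Fin 3))) (coeField U₀))
                    ((constrEnum (Bj ν.M₁ Z k) k).symm i).2.1)) ((t : ℂ) • ⟨cplxVec p, hp⟩))).re)) 0) ∧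
      -- DISPLAYED (T1@q₀) over the CLOSURE of NODE 00's class: the tower-central orbit of `U₀` is the unique minimal orbit
      (∀ U ∈ closure (Node00.regMSCoPOfRecord F 2 ν Kt k (maxDomT ν.M₁ Z)),
        AgreeOn (Bj ν.M₁ Z k) (avgFamily (Node00.avOfRecord F 2 Kt) U) (avgFamily (Node00.avOfRecord F 2 Kt) (qsstarGIter0 k (ext Vk))) →
        wilsonAction4 U ≤ wilsonAction4 U₀ →
          ∃ u : GaugeTransf (F.P Kt) 0 SU2, (∀ j, j ≤ k → ∀ b ∈ bondsOf (Bj ν.M₁ Z k j),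
            toMS u j b.src = toMS u j b.tgt ∧ ∀ g : SU2, toMS u j b.src * g = g * toMS u j b.src) ∧ gaugeAct u U = U₀)) :
    ∃ R : ℝ, 0 < R ∧ ∀ Vk ∈ K,
      ∃ Ũ : VecField (F.P Kt) k (EuclideanSpace ℂ (Fin 3)) × VecField (F.P Kt) k (EuclideanSpace ℂ (Fin 3)) → PBond (F.P Kt) 0 → Matrix (Fin 2) (Fin 2) ℂ,
        (∀ b i j, DifferentiableOn ℂ (fun z => Ũ z b i j) (ball 0 R)) ∧
        (∀ z ∈ ball (0 : VecField (F.P Kt) k (EuclideanSpace ℂ (Fin 3)) × VecField (F.P Kt) k (EuclideanSpace ℂ (Fin 3))) R, ∀ b i j, ‖Ũ z b i j‖ ≤ 𝓐₀) ∧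
        ∀ p B' : VecField (F.P Kt) k E3, ‖p‖ < R → ‖B'‖ < R → ∃ U' : GaugeField (F.P Kt) 0 SU2,
          (∀ b, Ũ (cplxVec p, cplxVec B') b = ((U' b : SU2) : Matrix (Fin 2) (Fin 2) ℂ)) ∧
            IsMinimizer (Node00.avOfRecord F 2 Kt) (Node00.regMSCoPOfRecord F 2 ν Kt k (maxDomT ν.M₁ Z)) (Bj ν.M₁ Z k)
              (avgFamily (Node00.avOfRecord F 2 Kt) (qsstarGIter0 k (expMul su2Chart B' (ext (expMul su2Chart p Vk))))) U' := by
  have hL := three_le_L (F.P Kt)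
  have hM4 : 4 * (F.P Kt).L ≤ ν.M₁ := le_trans (Nat.mul_le_mul_right _ (by omega)) hfloor
  exact hMin_atRecord_Bj_of_printLetters ν Kt k Z Λ lo hi (Nat.le_of_succ_le hkK) hk1 (Nat.le_succ k) hdiv hfloor hε hα3 hα2 ext hext hK h𝓐₀
    fun Vk hVk => by
      obtain ⟨U₀, hmin, hsbQ, hsbU, hguards, hβ, hT1⟩ := hbase Vk hVk
      exact ⟨U₀, hmin, hsbQ, hsbU, hguards,
        surjective_fderiv_msChart_Bj_of_isMinimizer_class ν Kt Z hkK hM4 hdiv hε.le hsbU' hερ hHB hεH hmin, hβ, hT1⟩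

end Summit.QuantumFields.YangMills.BalabanUVNodes.N12HsurjOfClass

end
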